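import Mathlib
import HarnessLib
import Summits.Ventures.LatticeQCDFlow.Scoring.SplitChainGaps

/-!
# Between regenerations the split chain moves by the residual kernel; the first regeneration
# cycle from a fresh start has mean length `1/ε` and satisfies the (truncated) KAC / CYCLE FORMULA

HONEST FRAMING: exact (Metropolis-corrected) sampling algorithms for lattice gauge theory;
figures of merit are autocorrelation/cost numbers at stated couplings and volumes; no
continuum-physics claim.

Venture `LatticeQCDFlow` (cell pub-lqcd), topic `Scoring`; FANOUT row 8 (`s0-cpn-nemc`, GEN-16).
NEW WORK of the cell, not a published result; no definition is introduced.  The split chain of a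
Doeblin kernel `κ(x, ·) ≥ ε ν` (`Scoring/SplitChain.lean`) regenerates from `ν` at every head and sees
`d` consecutive tails with weight `(1 − ε)^d` (`Scoring/SplitChainGaps.lean`).  Here: on TAILS the
state moves by the residual kernel `R = (κ − ε ν)/(1 − ε)`; hence, for the split chain started AT a
regeneration (initial law `ν.map (·, true)`) and `T_{0,t} := ∏_{1 ≤ s ≤ t} 1{coin_s = tails} = 1{t < τ}`
(`τ` the first head after time `0`): `E[T_{0,t} g(X_t)] = (1 − ε)^t ν(R^t g)`, the expected truncated
cycle length is `E[min(τ, n)] = (1 − (1 − ε)^n)/ε`, and for `π` invariant the DOEBLIN SERIES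
`π(g) = ε Σ_{t<n} (1 − ε)^t ν(R^t g) + (1 − ε)^n π(R^n g)` is the truncated KAC / CYCLE FORMULA
`ε · E[Σ_{t < min(τ,n)} g(X_t)] = π(g) + O((1 − ε)^n)`.  Printed counterpart NAMED ONLY: the cycle
formula for the invariant law of a regenerative / split chain (Kac 1947; Athreya–Ney 1978; Nummelin
1984 §5; Meyn–Tweedie 1993 Thm 10.0.1; Asmussen 2003 VI.1) and its use for regenerative MCMC error
bars (Mykland–Tierney–Yu 1995; Hobert–Jones–Presnell–Rosenthal 2002) — nothing is cited as a fact.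

## Content (`e = ε.toReal`, `R = Doeblin.residualKernel κ ν ε hmin`, `T_{b,d} = ∏_{i<d} 1{coin_{b+i+1} = tails}`)

* **`splitKernel_kop_tails`**, **`splitChain_tailsMove_dependsOn`**, **`splitChain_tailsRun_move`** —
  `E[G · T_{b,d} · g(X_{b+d})] = (1 − e)^d E[G · (R^d g)(X_b)]` for bounded measurable `G` with
  `DependsOn G (Set.Iic b)` (tails move by `R`);
* **`splitChain_fresh_tailsRun_move`**, `splitChain_fresh_tailsRun`, **`splitChain_fresh_cycleLength`** —
  fresh start: `E[T_{0,t} g(X_t)] = (1 − e)^t ν(R^t g)`, `E[T_{0,t}] = (1 − e)^t`,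
  `e · E[Σ_{t<n} T_{0,t}] = 1 − (1 − e)^n`;
* **`invariant_integral_eq_doeblin_series`**, `doeblin_series_remainder_le` — the Doeblin series of an
  invariant `π` and its remainder `≤ (1 − e)^n C`;
* **`splitChain_fresh_cycleSum_eq`**, **`splitChain_fresh_cycle_le`** — THE TRUNCATED CYCLE FORMULA
  `|e · E[Σ_{t<n} T_{0,t} g(X_t)] − π(g)| ≤ (1 − e)^n C`.

Reading (value-free): a regeneration cycle has mean length `1/ε`, and `ε` times the expected
occupation of a bounded observable over one cycle is its stationary mean (the identity behind the
regenerative estimator), with a geometric truncation error.  NOT CLAIMED: the un-truncated identity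
as a statement about `τ`; the i.i.d. structure of successive cycles; any `ε` of a concrete sampler.
-/

noncomputable section

namespace Summit.Ventures.LatticeQCDFlow.Scoring

open MeasureTheory ProbabilityTheory Filter Finset Preorder Literature.Probability.MarkovChains
open scoped ENNReal

/-! ### Bookkeeping -/

section Bookkeeping

variable {Ω : Type*}

/-- The test function "tails, times `g` of the state" is bounded by the bound of `g`, -/
theorem abs_tailsMul_le {g : Ω → ℝ} {C : ℝ} (hC : ∀ x, |g x| ≤ C) (p : Ω × Bool) :
    |(if p.2 then (0 : ℝ) else g p.1)| ≤ C := by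
  split_ifs
  · rw [abs_zero]; exact (abs_nonneg _).trans (hC p.1)
  · exact hC _

/-- the tails product from time `0`, `T_{0,t} = ∏_{i<t} 1{coin_{i+1} = tails}`, lies in `[0, 1]`, -/
theorem tailsProd₀_mem (t : ℕ) (x : ℕ → Ω × Bool) :
    0 ≤ ∏ i ∈ Finset.range t, (if (x (i + 1)).2 then (0 : ℝ) else 1)
      ∧ ∏ i ∈ Finset.range t, (if (x (i + 1)).2 then (0 : ℝ) else 1) ≤ 1 :=
  ⟨Finset.prod_nonneg fun i _ => by split_ifs <;> norm_num,
    Finset.prod_le_one (fun i _ => by split_ifs <;> norm_num) fun i _ => by split_ifs <;> norm_num⟩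

variable [MeasurableSpace Ω]

/-- "tails × `g`(state)" is measurable for measurable `g`, -/
theorem measurable_tailsMul {g : Ω → ℝ} (hg : Measurable g) :
    Measurable fun p : Ω × Bool => if p.2 then (0 : ℝ) else g p.1 := by
  refine Measurable.ite ?_ measurable_const (hg.comp measurable_fst)
  exact measurable_snd (measurableSet_singleton true)

/-- and so is the tails product from time `0`. -/
theorem measurable_tailsProd₀ (t : ℕ) : Measurable fun x : ℕ → Ω × Bool =>
    ∏ i ∈ Finset.range t, (if (x (i + 1)).2 then (0 : ℝ) else 1) :=
  Finset.measurable_prod _ fun i _ => measurable_coinTails (i + 1)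

end Bookkeeping

variable {Ω : Type*} [MeasurableSpace Ω]

/-! ### The split kernel on "tails × observable" -/

section SplitKernel

variable {κ : Kernel Ω Ω} [IsMarkovKernel κ] {ν : Measure Ω} [IsProbabilityMeasure ν] {ε : ℝ≥0∞}
  {hmin : ∀ x {B : Set Ω}, MeasurableSet B → ε * ν B ≤ κ x B}
  {κs : Kernel (Ω × Bool) (Ω × Bool)}

/-- **On "tails × g(state)" the split kernel moves by the residual kernel**:
`kop κ̂ (1{tails} · g) (x, b) = (1 − e) · (kop R g)(x)`. -/
theorem splitKernel_kop_tails (hε : ε < 1)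
    (hκs : ∀ p, κs p = (ε • ν).map (fun y : Ω => (y, true))
      + ((1 - ε) • Doeblin.residualKernel κ ν ε hmin p.1).map (fun y : Ω => (y, false)))
    {g : Ω → ℝ} (hg : Measurable g) {C : ℝ} (hC : ∀ x, |g x| ≤ C) (p : Ω × Bool) :
    kop κs (fun q : Ω × Bool => if q.2 then (0 : ℝ) else g q.1) p
      = (1 - ε.toReal) * kop (Doeblin.residualKernel κ ν ε hmin) g p.1 := by
  have h1 : (1 - ε).toReal = 1 - ε.toReal := by
    rw [ENNReal.toReal_sub_of_le hε.le ENNReal.one_ne_top, ENNReal.toReal_one]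
  rw [splitKernel_kop (κ := κ) (ν := ν) (hmin := hmin) hε hκs (measurable_tailsMul hg)
    (abs_tailsMul_le hC) p, h1]
  simp only [if_true, Bool.false_eq_true, if_false, integral_zero, mul_zero, zero_add]
  rfl

end SplitKernel

/-! ### The split chain: tails move by `R` -/

section SplitChain

variable {κ : Kernel Ω Ω} [IsMarkovKernel κ] {ν : Measure Ω} [IsProbabilityMeasure ν] {ε : ℝ≥0∞}
  {hmin : ∀ x {B : Set Ω}, MeasurableSet B → ε * ν B ≤ κ x B}
  (κs : Kernel (Ω × Bool) (Ω × Bool)) [IsMarkovKernel κs]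
  (μs : Measure (Ω × Bool)) [IsProbabilityMeasure μs]

/-- **TAILS MOVE BY THE RESIDUAL KERNEL (`DependsOn` form).**  For bounded measurable `G` with
`DependsOn G (Set.Iic b)` and bounded measurable `g`:
`E[G(X̂) · 1{coin_{b+1} = tails} · g(X_{b+1})] = (1 − e) · E[G(X̂) · (kop R g)(X_b)]`. -/
theorem splitChain_tailsMove_dependsOn (hε : ε < 1)
    (hκs : ∀ p, κs p = (ε • ν).map (fun y : Ω => (y, true))
      + ((1 - ε) • Doeblin.residualKernel κ ν ε hmin p.1).map (fun y : Ω => (y, false)))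
    (b : ℕ) {G : (ℕ → Ω × Bool) → ℝ} (hG : Measurable G) (hGd : DependsOn G (Set.Iic b))
    {CG : ℝ} (hCG : ∀ x, |G x| ≤ CG) {g : Ω → ℝ} (hg : Measurable g) {Cg : ℝ}
    (hCg : ∀ x, |g x| ≤ Cg) :
    ∫ x, G x * (if (x (b + 1)).2 then (0 : ℝ) else g (x (b + 1)).1)
        ∂(Kernel.trajMeasure (X := fun _ : ℕ => Ω × Bool) μs
          (fun n : ℕ => κs.comap (fun h : (i : ↥(Finset.Iic n)) → Ω × Bool =>
            h ⟨n, Finset.mem_Iic.2 le_rfl⟩) (measurable_pi_apply _)))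
      = (1 - ε.toReal) * ∫ x, G x * kop (Doeblin.residualKernel κ ν ε hmin) g (x b).1
        ∂(Kernel.trajMeasure (X := fun _ : ℕ => Ω × Bool) μs
          (fun n : ℕ => κs.comap (fun h : (i : ↥(Finset.Iic n)) → Ω × Bool =>
            h ⟨n, Finset.mem_Iic.2 le_rfl⟩) (measurable_pi_apply _))) := by
  rw [chain_tower_dependsOn κs μs b hG hGd hCG (measurable_tailsMul hg) (abs_tailsMul_le hCg)]
  simp_rw [splitKernel_kop_tails (κ := κ) (ν := ν) (hmin := hmin) hε hκs hg hCg]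
  rw [← integral_const_mul]
  refine integral_congr_ae (ae_of_all _ fun x => ?_)
  ring

/-- **NO REGENERATION FOR `d` UPDATES, THEN OBSERVE**: for bounded measurable `G` with
`DependsOn G (Set.Iic b)` and bounded measurable `g`,
`E[G(X̂) · ∏_{i<d} 1{coin_{b+i+1} = tails} · g(X_{b+d})] = (1 − e)^d · E[G(X̂) · (R^d g)(X_b)]` —
between regenerations the state is driven by the residual kernel. -/
theorem splitChain_tailsRun_move (hε : ε < 1)
    (hκs : ∀ p, κs p = (ε • ν).map (fun y : Ω => (y, true))
      + ((1 - ε) • Doeblin.residualKernel κ ν ε hmin p.1).map (fun y : Ω => (y, false)))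
    (b : ℕ) {G : (ℕ → Ω × Bool) → ℝ} (hG : Measurable G) (hGd : DependsOn G (Set.Iic b))
    {CG : ℝ} (hCG : ∀ x, |G x| ≤ CG) :
    ∀ (d : ℕ) {g : Ω → ℝ}, Measurable g → ∀ {Cg : ℝ}, (∀ x, |g x| ≤ Cg) →
    ∫ x, G x * (∏ i ∈ Finset.range d, (if (x (b + i + 1)).2 then (0 : ℝ) else 1))
          * g (x (b + d)).1
        ∂(Kernel.trajMeasure (X := fun _ : ℕ => Ω × Bool) μs
          (fun n : ℕ => κs.comap (fun h : (i : ↥(Finset.Iic n)) → Ω × Bool =>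
            h ⟨n, Finset.mem_Iic.2 le_rfl⟩) (measurable_pi_apply _)))
      = (1 - ε.toReal) ^ d * ∫ x, G x
          * (kop (Doeblin.residualKernel κ ν ε hmin))^[d] g (x b).1
        ∂(Kernel.trajMeasure (X := fun _ : ℕ => Ω × Bool) μs
          (fun n : ℕ => κs.comap (fun h : (i : ↥(Finset.Iic n)) → Ω × Bool =>
            h ⟨n, Finset.mem_Iic.2 le_rfl⟩) (measurable_pi_apply _)))
  | 0, g, _, _, _ => by simp
  | d + 1, g, hg, Cg, hCg => by
    haveI := Doeblin.isMarkovKernel_residualKernel (κ := κ) (ν := ν) (hmin := hmin) hε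
    -- the weight `G · T_{b,d}` depends on the past up to `b + d`
    have hG' : Measurable fun x : ℕ → Ω × Bool =>
        G x * ∏ i ∈ Finset.range d, (if (x (b + i + 1)).2 then (0 : ℝ) else 1) :=
      hG.mul (measurable_tailsProd b d)
    have hG'd : DependsOn (fun x : ℕ → Ω × Bool =>
        G x * ∏ i ∈ Finset.range d, (if (x (b + i + 1)).2 then (0 : ℝ) else 1))
        (Set.Iic (b + d)) := fun x y hxy => by
      show G x * _ = G y * _
      rw [hGd (fun i hi => hxy i (Set.Iic_subset_Iic.2 (Nat.le_add_right b d) hi))]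
      congr 1
      exact dependsOn_tailsProd b d hxy
    have hCG' : ∀ x : ℕ → Ω × Bool,
        |G x * ∏ i ∈ Finset.range d, (if (x (b + i + 1)).2 then (0 : ℝ) else 1)| ≤ CG := fun x => by
      rw [abs_mul, abs_of_nonneg (tailsProd_nonneg b d x)]
      exact (mul_le_of_le_one_right (abs_nonneg _) (tailsProd_le_one b d x)).trans (hCG x)
    have step := splitChain_tailsMove_dependsOn κs μs (κ := κ) (ν := ν) (hmin := hmin) hε hκs
      (b + d) hG' hG'd hCG' hg hCg
    have ih := splitChain_tailsRun_move hε hκs b hG hGd hCG d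
      (measurable_kop (Doeblin.residualKernel κ ν ε hmin) hg)
      (abs_kop_le (Doeblin.residualKernel κ ν ε hmin) hCg)
    have hpt : ∀ x : ℕ → Ω × Bool,
        G x * (∏ i ∈ Finset.range (d + 1), (if (x (b + i + 1)).2 then (0 : ℝ) else 1))
          * g (x (b + d + 1)).1
        = (G x * ∏ i ∈ Finset.range d, (if (x (b + i + 1)).2 then (0 : ℝ) else 1))
          * (if (x (b + d + 1)).2 then (0 : ℝ) else g (x (b + d + 1)).1) := fun x => by
      rw [Finset.prod_range_succ]
      split_ifs <;> ring
    rw [show b + (d + 1) = b + d + 1 from rfl]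
    simp_rw [hpt]
    rw [step, ih, pow_succ, Function.iterate_succ_apply]
    ring

/-- **From a fresh start (`ν̂ = ν ⊗ δ_true`): `E[T_{0,t} · g(X_t)] = (1 − e)^t · ν(R^t g)`** — no head
among the first `t` coins and then observe: the state has moved `t` residual steps from `ν`. -/
theorem splitChain_fresh_tailsRun_move (hε : ε < 1)
    (hκs : ∀ p, κs p = (ε • ν).map (fun y : Ω => (y, true))
      + ((1 - ε) • Doeblin.residualKernel κ ν ε hmin p.1).map (fun y : Ω => (y, false)))
    {g : Ω → ℝ} (hg : Measurable g) {Cg : ℝ} (hCg : ∀ x, |g x| ≤ Cg) (t : ℕ) :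
    ∫ x, (∏ i ∈ Finset.range t, (if (x (i + 1)).2 then (0 : ℝ) else 1)) * g (x t).1
        ∂(Kernel.trajMeasure (X := fun _ : ℕ => Ω × Bool) (ν.map (fun y : Ω => (y, true)))
          (fun n : ℕ => κs.comap (fun h : (i : ↥(Finset.Iic n)) → Ω × Bool =>
            h ⟨n, Finset.mem_Iic.2 le_rfl⟩) (measurable_pi_apply _)))
      = (1 - ε.toReal) ^ t * ∫ y, (kop (Doeblin.residualKernel κ ν ε hmin))^[t] g y ∂ν := by
  haveI hνt : IsProbabilityMeasure (ν.map (fun y : Ω => (y, true))) :=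
    Measure.isProbabilityMeasure_map (measurable_tagCoin true).aemeasurable
  haveI := Doeblin.isMarkovKernel_residualKernel (κ := κ) (ν := ν) (hmin := hmin) hε
  obtain ⟨hmt, -⟩ := iterate_kop_bounded_measurable (Doeblin.residualKernel κ ν ε hmin) hg hCg t
  have h := splitChain_tailsRun_move κs (ν.map (fun y : Ω => (y, true))) (κ := κ) (ν := ν)
    (hmin := hmin) hε hκs 0 (G := fun _ => (1 : ℝ)) measurable_const (fun _ _ _ => rfl) (CG := 1)
    (fun _ => by simp) t hg hCg
  simp only [one_mul, Nat.zero_add] at h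
  have hF : AEStronglyMeasurable
      (fun p : Ω × Bool => (kop (Doeblin.residualKernel κ ν ε hmin))^[t] g p.1)
      (ν.map (fun y : Ω => (y, true))) := (hmt.comp measurable_fst).aestronglyMeasurable
  rw [h, chain_initial κs (ν.map (fun y : Ω => (y, true)))
    (f := fun p : Ω × Bool => (kop (Doeblin.residualKernel κ ν ε hmin))^[t] g p.1)
    (hmt.comp measurable_fst), integral_map (measurable_tagCoin true).aemeasurable hF]

/-- **Fresh start: `E[T_{0,t}] = (1 − e)^t`** — the first cycle exceeds `t` with probability `(1 − ε)^t`. -/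
theorem splitChain_fresh_tailsRun (hε : ε < 1)
    (hκs : ∀ p, κs p = (ε • ν).map (fun y : Ω => (y, true))
      + ((1 - ε) • Doeblin.residualKernel κ ν ε hmin p.1).map (fun y : Ω => (y, false)))
    (t : ℕ) :
    ∫ x, (∏ i ∈ Finset.range t, (if (x (i + 1)).2 then (0 : ℝ) else 1))
        ∂(Kernel.trajMeasure (X := fun _ : ℕ => Ω × Bool) (ν.map (fun y : Ω => (y, true)))
          (fun n : ℕ => κs.comap (fun h : (i : ↥(Finset.Iic n)) → Ω × Bool =>
            h ⟨n, Finset.mem_Iic.2 le_rfl⟩) (measurable_pi_apply _)))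
      = (1 - ε.toReal) ^ t := by
  haveI hνt : IsProbabilityMeasure (ν.map (fun y : Ω => (y, true))) :=
    Measure.isProbabilityMeasure_map (measurable_tagCoin true).aemeasurable
  have h := splitChain_tailsRun κs (ν.map (fun y : Ω => (y, true))) (κ := κ) (ν := ν) (hmin := hmin)
    hε hκs 0 (G := fun _ => (1 : ℝ)) measurable_const (fun _ _ _ => rfl) (CG := 1) (fun _ => by simp) t
  simpa only [one_mul, Nat.zero_add, integral_const, probReal_univ, one_smul, mul_one] using h

/-- **EXPECTED TRUNCATED CYCLE LENGTH**: from a fresh start, `e · E[Σ_{t<n} T_{0,t}] = 1 − (1 − e)^n`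
(`Σ_{t<n} T_{0,t} = min(τ, n)`, `τ` the first head after time `0`: mean cycle length `↑ 1/ε`). -/
theorem splitChain_fresh_cycleLength (hε : ε < 1)
    (hκs : ∀ p, κs p = (ε • ν).map (fun y : Ω => (y, true))
      + ((1 - ε) • Doeblin.residualKernel κ ν ε hmin p.1).map (fun y : Ω => (y, false)))
    (n : ℕ) :
    ε.toReal * ∫ x, ∑ t ∈ Finset.range n,
        (∏ i ∈ Finset.range t, (if (x (i + 1)).2 then (0 : ℝ) else 1))
        ∂(Kernel.trajMeasure (X := fun _ : ℕ => Ω × Bool) (ν.map (fun y : Ω => (y, true)))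
          (fun n : ℕ => κs.comap (fun h : (i : ↥(Finset.Iic n)) → Ω × Bool =>
            h ⟨n, Finset.mem_Iic.2 le_rfl⟩) (measurable_pi_apply _)))
      = 1 - (1 - ε.toReal) ^ n := by
  haveI hνt : IsProbabilityMeasure (ν.map (fun y : Ω => (y, true))) :=
    Measure.isProbabilityMeasure_map (measurable_tagCoin true).aemeasurable
  rw [integral_finsetSum _ (fun t _ => integrable_of_bounded _ (measurable_tailsProd₀ t) (C := 1)
    (fun x => by rw [abs_of_nonneg ((tailsProd₀_mem t x).1)]; exact (tailsProd₀_mem t x).2))]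
  simp_rw [splitChain_fresh_tailsRun κs (κ := κ) (ν := ν) (hmin := hmin) hε hκs]
  rw [Finset.mul_sum]
  have key : ∀ m : ℕ, ∑ t ∈ Finset.range m, ε.toReal * (1 - ε.toReal) ^ t
      = 1 - (1 - ε.toReal) ^ m := by
    intro m
    induction m with
    | zero => simp
    | succ m ihm => rw [Finset.sum_range_succ, ihm, pow_succ]; ring
  exact key n

end SplitChain

/-! ### The Doeblin series for an invariant law -/

section Series

variable {κ : Kernel Ω Ω} [IsMarkovKernel κ] {ν : Measure Ω} [IsProbabilityMeasure ν] {ε : ℝ≥0∞}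
  {hmin : ∀ x {B : Set Ω}, MeasurableSet B → ε * ν B ≤ κ x B}
  {π : Measure Ω} [IsProbabilityMeasure π]

/-- **One invariant step splits**: for `π` invariant and bounded measurable `h`,
`π(h) = e · ν(h) + (1 − e) · π(kop R h)`. -/
theorem invariant_integral_eq_add_residual (hπ : Kernel.Invariant κ π) (hε : ε < 1) {h : Ω → ℝ}
    (hh : Measurable h) {C : ℝ} (hC : ∀ x, |h x| ≤ C) :
    ∫ x, h x ∂π = ε.toReal * ∫ y, h y ∂ν
      + (1 - ε.toReal) * ∫ x, kop (Doeblin.residualKernel κ ν ε hmin) h x ∂π := by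
  haveI := Doeblin.isMarkovKernel_residualKernel (κ := κ) (ν := ν) (hmin := hmin) hε
  have h1 : (1 - ε).toReal = 1 - ε.toReal := by
    rw [ENNReal.toReal_sub_of_le hε.le ENNReal.one_ne_top, ENNReal.toReal_one]
  rw [← integral_kop κ hπ hh hC]
  simp_rw [kop_eq_add_residual (κ := κ) (π := ν) (hmin := hmin) hε hh hC, h1]
  rw [integral_add (integrable_const _) (((integrable_of_bounded π
      (measurable_kop _ hh) (abs_kop_le _ hC))).const_mul _), integral_const, probReal_univ,
    one_smul, integral_const_mul]

/-- **THE DOEBLIN SERIES**: for `π` invariant, bounded measurable `g` and every `n`,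
`π(g) = e · Σ_{t<n} (1 − e)^t · ν(R^t g) + (1 − e)^n · π(R^n g)`. -/
theorem invariant_integral_eq_doeblin_series (hπ : Kernel.Invariant κ π) (hε : ε < 1) {g : Ω → ℝ}
    (hg : Measurable g) {C : ℝ} (hC : ∀ x, |g x| ≤ C) :
    ∀ n : ℕ, ∫ x, g x ∂π
      = ε.toReal * ∑ t ∈ Finset.range n, (1 - ε.toReal) ^ t
          * ∫ y, (kop (Doeblin.residualKernel κ ν ε hmin))^[t] g y ∂ν
        + (1 - ε.toReal) ^ n * ∫ x, (kop (Doeblin.residualKernel κ ν ε hmin))^[n] g x ∂π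
  | 0 => by simp
  | n + 1 => by
    haveI := Doeblin.isMarkovKernel_residualKernel (κ := κ) (ν := ν) (hmin := hmin) hε
    obtain ⟨hm, hb⟩ := iterate_kop_bounded_measurable (Doeblin.residualKernel κ ν ε hmin) hg hC n
    rw [invariant_integral_eq_doeblin_series hπ hε hg hC n,
      invariant_integral_eq_add_residual (κ := κ) (ν := ν) (hmin := hmin) hπ hε hm hb,
      Finset.sum_range_succ]
    have hit : kop (Doeblin.residualKernel κ ν ε hmin)
        ((kop (Doeblin.residualKernel κ ν ε hmin))^[n] g)
        = (kop (Doeblin.residualKernel κ ν ε hmin))^[n + 1] g :=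
      (Function.iterate_succ_apply' _ n g).symm
    rw [hit]
    ring

/-- **Remainder of the Doeblin series**: `|π(g) − e Σ_{t<n} (1 − e)^t ν(R^t g)| ≤ (1 − e)^n · C`. -/
theorem doeblin_series_remainder_le (hπ : Kernel.Invariant κ π) (hε : ε < 1) {g : Ω → ℝ}
    (hg : Measurable g) {C : ℝ} (hC : ∀ x, |g x| ≤ C) (n : ℕ) :
    |∫ x, g x ∂π - ε.toReal * ∑ t ∈ Finset.range n, (1 - ε.toReal) ^ t
        * ∫ y, (kop (Doeblin.residualKernel κ ν ε hmin))^[t] g y ∂ν|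
      ≤ (1 - ε.toReal) ^ n * C := by
  haveI := Doeblin.isMarkovKernel_residualKernel (κ := κ) (ν := ν) (hmin := hmin) hε
  obtain ⟨-, hb⟩ := iterate_kop_bounded_measurable (Doeblin.residualKernel κ ν ε hmin) hg hC n
  have he0 : 0 ≤ 1 - ε.toReal := by
    have := (ENNReal.toReal_lt_toReal (ne_top_of_lt hε) ENNReal.one_ne_top).2 hε
    rw [ENNReal.toReal_one] at this
    linarith
  have hint : |∫ x, (kop (Doeblin.residualKernel κ ν ε hmin))^[n] g x ∂π| ≤ C := by
    calc |∫ x, (kop (Doeblin.residualKernel κ ν ε hmin))^[n] g x ∂π|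
        = ‖∫ x, (kop (Doeblin.residualKernel κ ν ε hmin))^[n] g x ∂π‖ := (Real.norm_eq_abs _).symm
      _ ≤ C * π.real Set.univ := norm_integral_le_of_norm_le_const (Eventually.of_forall fun y => by
          rw [Real.norm_eq_abs]; exact hb y)
      _ = C := by rw [probReal_univ, mul_one]
  rw [invariant_integral_eq_doeblin_series (κ := κ) (ν := ν) (hmin := hmin) hπ hε hg hC n,
    add_sub_cancel_left, abs_mul, abs_of_nonneg (pow_nonneg he0 n)]
  exact mul_le_mul_of_nonneg_left hint (pow_nonneg he0 n)

end Series

/-! ### The truncated cycle formula -/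

section Cycle

variable {κ : Kernel Ω Ω} [IsMarkovKernel κ] {ν : Measure Ω} [IsProbabilityMeasure ν] {ε : ℝ≥0∞}
  {hmin : ∀ x {B : Set Ω}, MeasurableSet B → ε * ν B ≤ κ x B}
  (κs : Kernel (Ω × Bool) (Ω × Bool)) [IsMarkovKernel κs]

/-- **The expected occupation of the truncated first cycle**: from a fresh start,
`E[Σ_{t<n} T_{0,t} · g(X_t)] = Σ_{t<n} (1 − e)^t · ν(R^t g)`. -/
theorem splitChain_fresh_cycleSum_eq (hε : ε < 1)
    (hκs : ∀ p, κs p = (ε • ν).map (fun y : Ω => (y, true))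
      + ((1 - ε) • Doeblin.residualKernel κ ν ε hmin p.1).map (fun y : Ω => (y, false)))
    {g : Ω → ℝ} (hg : Measurable g) {Cg : ℝ} (hCg : ∀ x, |g x| ≤ Cg) (n : ℕ) :
    ∫ x, ∑ t ∈ Finset.range n,
        (∏ i ∈ Finset.range t, (if (x (i + 1)).2 then (0 : ℝ) else 1)) * g (x t).1
        ∂(Kernel.trajMeasure (X := fun _ : ℕ => Ω × Bool) (ν.map (fun y : Ω => (y, true)))
          (fun n : ℕ => κs.comap (fun h : (i : ↥(Finset.Iic n)) → Ω × Bool =>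
            h ⟨n, Finset.mem_Iic.2 le_rfl⟩) (measurable_pi_apply _)))
      = ∑ t ∈ Finset.range n, (1 - ε.toReal) ^ t
          * ∫ y, (kop (Doeblin.residualKernel κ ν ε hmin))^[t] g y ∂ν := by
  haveI hνt : IsProbabilityMeasure (ν.map (fun y : Ω => (y, true))) :=
    Measure.isProbabilityMeasure_map (measurable_tagCoin true).aemeasurable
  have hint : ∀ t ∈ Finset.range n, Integrable (fun x : ℕ → Ω × Bool =>
      (∏ i ∈ Finset.range t, (if (x (i + 1)).2 then (0 : ℝ) else 1)) * g (x t).1)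
      (Kernel.trajMeasure (X := fun _ : ℕ => Ω × Bool) (ν.map (fun y : Ω => (y, true)))
        (fun n : ℕ => κs.comap (fun h : (i : ↥(Finset.Iic n)) → Ω × Bool =>
          h ⟨n, Finset.mem_Iic.2 le_rfl⟩) (measurable_pi_apply _))) := fun t _ => by
    refine integrable_of_bounded _ ((measurable_tailsProd₀ t).mul
      (hg.comp (measurable_fst.comp (measurable_pi_apply t)))) (C := 1 * Cg) fun x => ?_
    rw [abs_mul, abs_of_nonneg ((tailsProd₀_mem t x).1)]
    exact mul_le_mul ((tailsProd₀_mem t x).2) (hCg _) (abs_nonneg _) zero_le_one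
  rw [integral_finsetSum _ hint]
  exact Finset.sum_congr rfl fun t _ =>
    splitChain_fresh_tailsRun_move κs (κ := κ) (ν := ν) (hmin := hmin) hε hκs hg hCg t

/-- **THE TRUNCATED CYCLE FORMULA (Kac).**  For `π` invariant, `κ(x, ·) ≥ ε ν` (`ε < 1`), bounded
measurable `g` (`|g| ≤ C`) and every horizon `n`: from a fresh start `ν ⊗ δ_true` of the split chain,
`|e · E[Σ_{t<n} T_{0,t} · g(X_t)] − π(g)| ≤ (1 − e)^n · C` — `ε` times the expected occupation of `g`
over the first regeneration cycle, truncated at `n`, is the stationary mean up to a geometric error. -/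
theorem splitChain_fresh_cycle_le {π : Measure Ω} [IsProbabilityMeasure π]
    (hπ : Kernel.Invariant κ π) (hε : ε < 1)
    (hκs : ∀ p, κs p = (ε • ν).map (fun y : Ω => (y, true))
      + ((1 - ε) • Doeblin.residualKernel κ ν ε hmin p.1).map (fun y : Ω => (y, false)))
    {g : Ω → ℝ} (hg : Measurable g) {C : ℝ} (hC : ∀ x, |g x| ≤ C) (n : ℕ) :
    |ε.toReal * ∫ x, ∑ t ∈ Finset.range n,
        (∏ i ∈ Finset.range t, (if (x (i + 1)).2 then (0 : ℝ) else 1)) * g (x t).1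
        ∂(Kernel.trajMeasure (X := fun _ : ℕ => Ω × Bool) (ν.map (fun y : Ω => (y, true)))
          (fun n : ℕ => κs.comap (fun h : (i : ↥(Finset.Iic n)) → Ω × Bool =>
            h ⟨n, Finset.mem_Iic.2 le_rfl⟩) (measurable_pi_apply _)))
      - ∫ x, g x ∂π| ≤ (1 - ε.toReal) ^ n * C := by
  rw [splitChain_fresh_cycleSum_eq κs (κ := κ) (ν := ν) (hmin := hmin) hε hκs hg hC n, abs_sub_comm]
  exact doeblin_series_remainder_le (κ := κ) (ν := ν) (hmin := hmin) hπ hε hg hC n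

end Cycle

end Summit.Ventures.LatticeQCDFlow.Scoring

end
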